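import Mathlib
import HarnessLib

/-!
# Prop. 7 on T³ — lane II (B7-BUDGET): the per-patch and summed real bookkeeping of the (REC) assembly

Route `UnitScaleTilt`, crux `MinimiserStabilityRegPr` (stmt-QuantumFields-19200), E′ growth side, lane II «divergence recovery at the curved regular member».
Companion of ✓`UnitScaleTiltProp7DivRecoveryAssemblyCore` ((B7-CORE), the Hilbert-space identity; its §5 `norm_sq_le_rows_H1` is the row consumed here,
with `T :=` the comb averaging of record — LANE II NAMER WORD №9): here NO vector spaces at all — the patch-indexed REAL rows of the bricks (B1′) box
Friedrichs, (B8) local potentials (Pythagoras, Poincaré `R`, source), (B6) cutoff commutators (mass and `H¹` energy), the blockwise Poincaré ∕ (B9) coarse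
box Poincaré ∕ local intertwining chain for the gradient-cutoff term, the interior Weitzenböck row for the cut-off transverse remainder, and the
bounded-overlap sums are chained into the collected row `‖g‖² ≤ A₁·AVG + A₂·CURL⁺ + (A₃·R⁻² + A₄·e)·‖y‖²` (coefficients explicit in the brick constants;
the member chooses `R = R(L,δ)` with `A₃R⁻² ≤ δ` and `eR` with `A₄·eR` finite — (REC)'s shape).

* §1 `patch_budget` — one patch: eleven displayed rows ⟹ seven bounds (`Φ ρ K L M Hρ HM`) in the currencies `(As, Cu, R⁻²N, e·N)`.
* §2 `summed_budget` — `ν`-fold overlap sums + the (B7-CORE) §5 row ⟹ the collected row.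
* §3 `rec_shape_of_collected` — Layer A: the collected row + `V ≤ P + G` + `CURL ≥ −1029e·N` + `A₃R⁻² ≤ δ` ⟹ (REC)'s per-member shape.

HONEST SCOPE.  Elementary real inequalities; every row is a hypothesis; nothing of (REC)∕hN06∕hcoS∕E′∕EX∕the crux is proved here; YM₃ on T³ is rung R3 —
NOT d = 4, NOT infinite volume, NOT a mass gap, NOT Clay.
[cite: Balaban1985BackgroundPropagators, (3.10) p.392, (3.19)-(3.26) pp.393-395, Thm 3.11 p.416]
-/

noncomputable section

open scoped BigOperators

namespace Summit.QuantumFields.YangMills.Theorems.Prop7DivRecoveryAssemblyBudget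

/-! ## §1 One patch -/

/-- ★★ **(B7-BUDGET) ONE PATCH.**  Reals of one patch `Ω`: `N` (mass of `y` on `Ω`), `Cu` (curl⁺ of `y` on `Ω`), `As` (comb averages of `y` on the inner coarse
patch), `Gφ = ‖D_Wφ‖²`, `Φ = ‖φ‖²`, `ρ = ‖r‖²` (`r = y − D_Wφ`), `K = ‖κ‖²`, `L = ‖[Δ_W,ζ]φ‖²`, `M = ‖[D_W,ζ]φ‖²`, `Hρ` ∕ `HM` (the `curl ⊕ div` energies of `ζr` and of
`[D_W,ζ]φ`), `Φt` (mass of `φ` on the transition blocks), `Nt` (coarse mass of its block means there), `Gc` (covariant coarse gradient of the block means on the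
inner coarse patch).  Rows: (B8) `h1 : Gφ ≤ N`, `h2 : Φ ≤ CΦR²·Gφ`, `h3 : K ≤ C8R²e²·ρ`; (B1′) `h4 : ρ ≤ CF·R²·(Cu + e²Φ + K)` in the window
`hwin : CF·C8·R⁴e² ≤ ½`; (B6) `h5 : L ≤ Cζ(R⁻²N + R⁻⁴Φ)`, `h6 : M ≤ CM·R⁻²·Φt`, `h11 : HM ≤ CH·(R⁻²Gφ + R⁻⁴Φ)`; blockwise Poincaré `h7 : Φt ≤ CP(Gφ + e²Φ) + Nt`;
(B9)+(B8) `h8 : Nt ≤ C9R²·Gc + C9′R⁴e²·Φ`; local intertwining ⊕ (QH1) `h9 : Gc ≤ 4As + B·ρ + BC·Cu + BK·K + Ct·e²Φ`; interior Weitzenböck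
`h10 : Hρ ≤ CW·(Cu + e²Φ + K + R⁻²ρ)`.  Conclusions in the currencies `(As, Cu, R⁻²N, eN)` (`R ≥ 1`, `0 ≤ e ≤ 1`). [folklore] -/
theorem patch_budget {N Cu As Gφ Φ ρ K L M Hρ HM Φt Nt Gc R e CΦ C8 CF Cζ CM CH CP C9 C9' B BC BK Ct CW : ℝ}
    (hN : 0 ≤ N) (hCu : 0 ≤ Cu) (hρ0 : 0 ≤ ρ) (hΦ0 : 0 ≤ Φ)
    (hR : 1 ≤ R) (he0 : 0 ≤ e) (he1 : e ≤ 1)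
    (hCΦ : 0 ≤ CΦ) (hC8 : 0 ≤ C8) (hCF : 0 ≤ CF) (hCζ : 0 ≤ Cζ) (hCM : 0 ≤ CM) (hCH : 0 ≤ CH) (hCP : 0 ≤ CP) (hC9 : 0 ≤ C9) (hC9' : 0 ≤ C9')
    (hB : 0 ≤ B) (hBK : 0 ≤ BK) (hCt : 0 ≤ Ct) (hCW : 0 ≤ CW)
    (h1 : Gφ ≤ N) (h2 : Φ ≤ CΦ * R ^ 2 * Gφ) (h3 : K ≤ C8 * R ^ 2 * e ^ 2 * ρ) (h4 : ρ ≤ CF * R ^ 2 * (Cu + e ^ 2 * Φ + K))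
    (hwin : CF * C8 * R ^ 4 * e ^ 2 ≤ 1 / 2)
    (h5 : L ≤ Cζ * (R⁻¹ ^ 2 * N + R⁻¹ ^ 4 * Φ)) (h6 : M ≤ CM * R⁻¹ ^ 2 * Φt) (h7 : Φt ≤ CP * (Gφ + e ^ 2 * Φ) + Nt)
    (h8 : Nt ≤ C9 * R ^ 2 * Gc + C9' * R ^ 4 * e ^ 2 * Φ) (h9 : Gc ≤ 4 * As + B * ρ + BC * Cu + BK * K + Ct * e ^ 2 * Φ)
    (h10 : Hρ ≤ CW * (Cu + e ^ 2 * Φ + K + R⁻¹ ^ 2 * ρ)) (h11 : HM ≤ CH * (R⁻¹ ^ 2 * Gφ + R⁻¹ ^ 4 * Φ)) :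
    Φ ≤ CΦ * R ^ 2 * N ∧
    ρ ≤ 2 * CF * R ^ 2 * Cu + 2 * CF * CΦ * R ^ 4 * e * N ∧
    K ≤ 2 * C8 * CF * R ^ 4 * Cu + 2 * C8 * CF * CΦ * R ^ 6 * e * N ∧
    L ≤ Cζ * (1 + CΦ) * R⁻¹ ^ 2 * N ∧
    M ≤ 4 * CM * C9 * As + CM * C9 * (2 * (B + BK * C8 * R ^ 2) * CF * R ^ 2 + BC) * Cu
        + (CM * CP * R⁻¹ ^ 2
            + (CM * CP * CΦ + CM * C9 * Ct * CΦ * R ^ 2 + CM * C9' * CΦ * R ^ 4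
                + CM * C9 * 2 * (B + BK * C8 * R ^ 2) * CF * CΦ * R ^ 4) * e) * N ∧
    Hρ ≤ CW * (1 + 2 * CF + 2 * C8 * CF * R ^ 4) * Cu + CW * (CΦ * R ^ 2 + 2 * CF * CΦ * R ^ 2 + 2 * C8 * CF * CΦ * R ^ 6) * e * N ∧
    HM ≤ CH * (1 + CΦ) * R⁻¹ ^ 2 * N := by
  have hR0 : 0 < R := by linarith
  have hRi : R⁻¹ * R = 1 := inv_mul_cancel₀ hR0.ne'
  have hRi0 : 0 ≤ R⁻¹ := inv_nonneg.mpr hR0.le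
  have he2 : e ^ 2 ≤ e := by rw [pow_two]; exact mul_le_of_le_one_left he0 he1
  have he21 : e ^ 2 ≤ 1 := he2.trans he1
  have he20 : 0 ≤ e ^ 2 := sq_nonneg e
  have hRR2 : R⁻¹ ^ 2 * R ^ 2 = 1 := by rw [← mul_pow, hRi, one_pow]
  have hRR4 : R⁻¹ ^ 2 * R ^ 4 = R ^ 2 := by
    calc R⁻¹ ^ 2 * R ^ 4 = (R⁻¹ ^ 2 * R ^ 2) * R ^ 2 := by ring
      _ = R ^ 2 := by rw [hRR2, one_mul]
  have hRR6 : R⁻¹ ^ 2 * R ^ 6 = R ^ 4 := by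
    calc R⁻¹ ^ 2 * R ^ 6 = (R⁻¹ ^ 2 * R ^ 2) * R ^ 4 := by ring
      _ = R ^ 4 := by rw [hRR2, one_mul]
  have hR4Φ : R⁻¹ ^ 4 * (CΦ * R ^ 2 * N) = R⁻¹ ^ 2 * (CΦ * N) := by
    calc R⁻¹ ^ 4 * (CΦ * R ^ 2 * N) = (R⁻¹ * R) ^ 2 * (R⁻¹ ^ 2 * (CΦ * N)) := by ring
      _ = R⁻¹ ^ 2 * (CΦ * N) := by rw [hRi, one_pow, one_mul]
  -- (1) Φ
  have hΦ : Φ ≤ CΦ * R ^ 2 * N := h2.trans (mul_le_mul_of_nonneg_left h1 (by positivity))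
  have heΦ : e ^ 2 * Φ ≤ e * (CΦ * R ^ 2 * N) := mul_le_mul he2 hΦ hΦ0 he0
  -- (2) ρ : resolve the circle ρ ↔ K in the window
  have hρ : ρ ≤ 2 * CF * R ^ 2 * Cu + 2 * CF * CΦ * R ^ 4 * e * N := by
    have hK' : CF * R ^ 2 * K ≤ (1 / 2) * ρ := by
      calc CF * R ^ 2 * K ≤ CF * R ^ 2 * (C8 * R ^ 2 * e ^ 2 * ρ) := mul_le_mul_of_nonneg_left h3 (by positivity)
        _ = (CF * C8 * R ^ 4 * e ^ 2) * ρ := by ring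
        _ ≤ (1 / 2) * ρ := mul_le_mul_of_nonneg_right hwin hρ0
    have hΦ' : CF * R ^ 2 * (e ^ 2 * Φ) ≤ CF * CΦ * R ^ 4 * e * N := by
      calc CF * R ^ 2 * (e ^ 2 * Φ) ≤ CF * R ^ 2 * (e * (CΦ * R ^ 2 * N)) := mul_le_mul_of_nonneg_left heΦ (by positivity)
        _ = CF * CΦ * R ^ 4 * e * N := by ring
    have : ρ ≤ CF * R ^ 2 * Cu + CF * R ^ 2 * (e ^ 2 * Φ) + CF * R ^ 2 * K := by rw [← mul_add, ← mul_add]; exact h4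
    linarith
  -- (3) K
  have hK : K ≤ 2 * C8 * CF * R ^ 4 * Cu + 2 * C8 * CF * CΦ * R ^ 6 * e * N := by
    have hKe : K ≤ C8 * R ^ 2 * e ^ 2 * (2 * CF * R ^ 2 * Cu + 2 * CF * CΦ * R ^ 4 * e * N) :=
      h3.trans (mul_le_mul_of_nonneg_left hρ (by positivity))
    have he2Cu : e ^ 2 * Cu ≤ Cu := mul_le_of_le_one_left hCu he21
    have heeN : e ^ 2 * (e * N) ≤ e * N := mul_le_of_le_one_left (mul_nonneg he0 hN) he21
    have hA : C8 * R ^ 2 * e ^ 2 * (2 * CF * R ^ 2 * Cu) ≤ 2 * C8 * CF * R ^ 4 * Cu := by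
      calc C8 * R ^ 2 * e ^ 2 * (2 * CF * R ^ 2 * Cu) = 2 * C8 * CF * R ^ 4 * (e ^ 2 * Cu) := by ring
        _ ≤ 2 * C8 * CF * R ^ 4 * Cu := mul_le_mul_of_nonneg_left he2Cu (by positivity)
    have hB' : C8 * R ^ 2 * e ^ 2 * (2 * CF * CΦ * R ^ 4 * e * N) ≤ 2 * C8 * CF * CΦ * R ^ 6 * e * N := by
      calc C8 * R ^ 2 * e ^ 2 * (2 * CF * CΦ * R ^ 4 * e * N) = 2 * C8 * CF * CΦ * R ^ 6 * (e ^ 2 * (e * N)) := by ring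
        _ ≤ 2 * C8 * CF * CΦ * R ^ 6 * (e * N) := mul_le_mul_of_nonneg_left heeN (by positivity)
        _ = 2 * C8 * CF * CΦ * R ^ 6 * e * N := by ring
    have hsplit : C8 * R ^ 2 * e ^ 2 * (2 * CF * R ^ 2 * Cu + 2 * CF * CΦ * R ^ 4 * e * N)
        = C8 * R ^ 2 * e ^ 2 * (2 * CF * R ^ 2 * Cu) + C8 * R ^ 2 * e ^ 2 * (2 * CF * CΦ * R ^ 4 * e * N) := by ring
    rw [hsplit] at hKe
    linarith
  -- (4) L
  have hL : L ≤ Cζ * (1 + CΦ) * R⁻¹ ^ 2 * N := by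
    have hΦ'' : R⁻¹ ^ 4 * Φ ≤ R⁻¹ ^ 2 * (CΦ * N) := by
      calc R⁻¹ ^ 4 * Φ ≤ R⁻¹ ^ 4 * (CΦ * R ^ 2 * N) := mul_le_mul_of_nonneg_left hΦ (by positivity)
        _ = R⁻¹ ^ 2 * (CΦ * N) := hR4Φ
    calc L ≤ Cζ * (R⁻¹ ^ 2 * N + R⁻¹ ^ 4 * Φ) := h5
      _ ≤ Cζ * (R⁻¹ ^ 2 * N + R⁻¹ ^ 2 * (CΦ * N)) := by apply mul_le_mul_of_nonneg_left _ hCζ; linarith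
      _ = Cζ * (1 + CΦ) * R⁻¹ ^ 2 * N := by ring
  -- (5) M
  have hM : M ≤ 4 * CM * C9 * As + CM * C9 * (2 * (B + BK * C8 * R ^ 2) * CF * R ^ 2 + BC) * Cu
      + (CM * CP * R⁻¹ ^ 2
          + (CM * CP * CΦ + CM * C9 * Ct * CΦ * R ^ 2 + CM * C9' * CΦ * R ^ 4
              + CM * C9 * 2 * (B + BK * C8 * R ^ 2) * CF * CΦ * R ^ 4) * e) * N := by
    -- `B ρ + BK K ≤ (B + BK·C8R²)·ρ` via `K ≤ C8 R² e² ρ ≤ C8 R² ρ` (`e² ≤ 1`)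
    have hKρ : K ≤ C8 * R ^ 2 * ρ := by
      calc K ≤ C8 * R ^ 2 * e ^ 2 * ρ := h3
        _ = C8 * R ^ 2 * (e ^ 2 * ρ) := by ring
        _ ≤ C8 * R ^ 2 * ρ := mul_le_mul_of_nonneg_left (mul_le_of_le_one_left hρ0 he21) (by positivity)
    have hGc : Gc ≤ 4 * As + (B + BK * C8 * R ^ 2) * ρ + BC * Cu + Ct * e ^ 2 * Φ := by
      have := mul_le_mul_of_nonneg_left hKρ hBK
      have hid' : (B + BK * C8 * R ^ 2) * ρ = B * ρ + BK * (C8 * R ^ 2 * ρ) := by ring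
      rw [hid']
      linarith
    set B2 : ℝ := B + BK * C8 * R ^ 2 with hB2
    have hB20 : 0 ≤ B2 := by rw [hB2]; positivity
    have hGc' : Gc ≤ 4 * As + 2 * B2 * CF * R ^ 2 * Cu + 2 * B2 * CF * CΦ * R ^ 4 * e * N + BC * Cu + Ct * CΦ * R ^ 2 * e * N := by
      have hρ' := mul_le_mul_of_nonneg_left hρ hB20
      have hΦ' : Ct * e ^ 2 * Φ ≤ Ct * CΦ * R ^ 2 * e * N := by
        calc Ct * e ^ 2 * Φ = Ct * (e ^ 2 * Φ) := by ring
          _ ≤ Ct * (e * (CΦ * R ^ 2 * N)) := mul_le_mul_of_nonneg_left heΦ hCt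
          _ = Ct * CΦ * R ^ 2 * e * N := by ring
      linarith
    have hNt : Nt ≤ C9 * R ^ 2 * (4 * As + 2 * B2 * CF * R ^ 2 * Cu + 2 * B2 * CF * CΦ * R ^ 4 * e * N + BC * Cu + Ct * CΦ * R ^ 2 * e * N)
        + C9' * CΦ * R ^ 6 * e * N := by
      have hA := mul_le_mul_of_nonneg_left hGc' (show 0 ≤ C9 * R ^ 2 by positivity)
      have hΦ' : C9' * R ^ 4 * e ^ 2 * Φ ≤ C9' * CΦ * R ^ 6 * e * N := by
        calc C9' * R ^ 4 * e ^ 2 * Φ = C9' * R ^ 4 * (e ^ 2 * Φ) := by ring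
          _ ≤ C9' * R ^ 4 * (e * (CΦ * R ^ 2 * N)) := mul_le_mul_of_nonneg_left heΦ (by positivity)
          _ = C9' * CΦ * R ^ 6 * e * N := by ring
      linarith
    have hΦt : Φt ≤ CP * N + CP * CΦ * R ^ 2 * e * N + Nt := by
      have hΦ' : e ^ 2 * Φ ≤ CΦ * R ^ 2 * e * N := by linarith [heΦ]
      have := mul_le_mul_of_nonneg_left (add_le_add h1 hΦ') hCP
      linarith
    have hstep : M ≤ CM * R⁻¹ ^ 2 * (CP * N + CP * CΦ * R ^ 2 * e * N
        + (C9 * R ^ 2 * (4 * As + 2 * B2 * CF * R ^ 2 * Cu + 2 * B2 * CF * CΦ * R ^ 4 * e * N + BC * Cu + Ct * CΦ * R ^ 2 * e * N)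
          + C9' * CΦ * R ^ 6 * e * N)) := by
      calc M ≤ CM * R⁻¹ ^ 2 * Φt := h6
        _ ≤ _ := by apply mul_le_mul_of_nonneg_left _ (by positivity); linarith
    have hexp : CM * R⁻¹ ^ 2 * (CP * N + CP * CΦ * R ^ 2 * e * N
        + (C9 * R ^ 2 * (4 * As + 2 * B2 * CF * R ^ 2 * Cu + 2 * B2 * CF * CΦ * R ^ 4 * e * N + BC * Cu + Ct * CΦ * R ^ 2 * e * N)
          + C9' * CΦ * R ^ 6 * e * N))
        = CM * CP * R⁻¹ ^ 2 * N + CM * CP * CΦ * (R⁻¹ ^ 2 * R ^ 2) * e * N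
          + 4 * CM * C9 * (R⁻¹ ^ 2 * R ^ 2) * As + 2 * CM * C9 * B2 * CF * (R⁻¹ ^ 2 * R ^ 4) * Cu
          + 2 * CM * C9 * B2 * CF * CΦ * (R⁻¹ ^ 2 * R ^ 6) * e * N + CM * C9 * BC * (R⁻¹ ^ 2 * R ^ 2) * Cu
          + CM * C9 * Ct * CΦ * (R⁻¹ ^ 2 * R ^ 4) * e * N + CM * C9' * CΦ * (R⁻¹ ^ 2 * R ^ 6) * e * N := by ring
    rw [hexp, hRR2, hRR4, hRR6] at hstep
    have hid : CM * CP * R⁻¹ ^ 2 * N + CM * CP * CΦ * 1 * e * N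
          + 4 * CM * C9 * 1 * As + 2 * CM * C9 * B2 * CF * R ^ 2 * Cu
          + 2 * CM * C9 * B2 * CF * CΦ * R ^ 4 * e * N + CM * C9 * BC * 1 * Cu
          + CM * C9 * Ct * CΦ * R ^ 2 * e * N + CM * C9' * CΦ * R ^ 4 * e * N
        = 4 * CM * C9 * As + CM * C9 * (2 * B2 * CF * R ^ 2 + BC) * Cu
          + (CM * CP * R⁻¹ ^ 2 + (CM * CP * CΦ + CM * C9 * Ct * CΦ * R ^ 2 + CM * C9' * CΦ * R ^ 4
              + CM * C9 * 2 * B2 * CF * CΦ * R ^ 4) * e) * N := by ring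
    rw [hid] at hstep
    rw [hB2] at hstep
    exact hstep
  -- (6) Hρ
  have hHρ : Hρ ≤ CW * (1 + 2 * CF + 2 * C8 * CF * R ^ 4) * Cu
      + CW * (CΦ * R ^ 2 + 2 * CF * CΦ * R ^ 2 + 2 * C8 * CF * CΦ * R ^ 6) * e * N := by
    have hρ' : R⁻¹ ^ 2 * ρ ≤ 2 * CF * Cu + 2 * CF * CΦ * R ^ 2 * e * N := by
      calc R⁻¹ ^ 2 * ρ ≤ R⁻¹ ^ 2 * (2 * CF * R ^ 2 * Cu + 2 * CF * CΦ * R ^ 4 * e * N) := mul_le_mul_of_nonneg_left hρ (by positivity)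
        _ = 2 * CF * (R⁻¹ ^ 2 * R ^ 2) * Cu + 2 * CF * CΦ * (R⁻¹ ^ 2 * R ^ 4) * e * N := by ring
        _ = 2 * CF * Cu + 2 * CF * CΦ * R ^ 2 * e * N := by rw [hRR2, hRR4, mul_one]
    have hsum : Cu + e ^ 2 * Φ + K + R⁻¹ ^ 2 * ρ ≤ (1 + 2 * CF + 2 * C8 * CF * R ^ 4) * Cu
        + (CΦ * R ^ 2 + 2 * CF * CΦ * R ^ 2 + 2 * C8 * CF * CΦ * R ^ 6) * e * N := by
      have h' : e ^ 2 * Φ ≤ CΦ * R ^ 2 * e * N := by linarith [heΦ]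
      have hid' : (1 + 2 * CF + 2 * C8 * CF * R ^ 4) * Cu + (CΦ * R ^ 2 + 2 * CF * CΦ * R ^ 2 + 2 * C8 * CF * CΦ * R ^ 6) * e * N
          = Cu + CΦ * R ^ 2 * e * N + (2 * C8 * CF * R ^ 4 * Cu + 2 * C8 * CF * CΦ * R ^ 6 * e * N)
            + (2 * CF * Cu + 2 * CF * CΦ * R ^ 2 * e * N) := by ring
      rw [hid']
      linarith [hK, hρ', h']
    calc Hρ ≤ CW * (Cu + e ^ 2 * Φ + K + R⁻¹ ^ 2 * ρ) := h10
      _ ≤ CW * ((1 + 2 * CF + 2 * C8 * CF * R ^ 4) * Cu + (CΦ * R ^ 2 + 2 * CF * CΦ * R ^ 2 + 2 * C8 * CF * CΦ * R ^ 6) * e * N) :=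
          mul_le_mul_of_nonneg_left hsum hCW
      _ = _ := by ring
  -- (7) HM
  have hHM : HM ≤ CH * (1 + CΦ) * R⁻¹ ^ 2 * N := by
    have hΦ'' : R⁻¹ ^ 4 * Φ ≤ R⁻¹ ^ 2 * (CΦ * N) := by
      calc R⁻¹ ^ 4 * Φ ≤ R⁻¹ ^ 4 * (CΦ * R ^ 2 * N) := mul_le_mul_of_nonneg_left hΦ (by positivity)
        _ = R⁻¹ ^ 2 * (CΦ * N) := hR4Φ
    have hG' : R⁻¹ ^ 2 * Gφ ≤ R⁻¹ ^ 2 * N := mul_le_mul_of_nonneg_left h1 (by positivity)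
    calc HM ≤ CH * (R⁻¹ ^ 2 * Gφ + R⁻¹ ^ 4 * Φ) := h11
      _ ≤ CH * (R⁻¹ ^ 2 * N + R⁻¹ ^ 2 * (CΦ * N)) := by apply mul_le_mul_of_nonneg_left _ hCH; linarith
      _ = CH * (1 + CΦ) * R⁻¹ ^ 2 * N := by ring
  exact ⟨hΦ, hρ, hK, hL, hM, hHρ, hHM⟩

/-! ## §2 The sum over patches -/

/-- ★★★ **(B7-BUDGET) THE COLLECTED ROW.**  Patches `i : ι` with per-patch bounds in the currencies `(As_i, Cu_i, R⁻²N_i, eN_i)` (the outputs of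
`patch_budget`, coefficients arbitrary nonnegative reals — the member plugs the displayed polynomials in `R`), `ν`-fold overlap (`Σ N_i ≤ νN`, `Σ Cu_i ≤ ν·C⁺`,
`Σ As_i ≤ ν·AVG`), the bounded-overlap rows for the seven global reals of (B7-CORE) §5 (`Sr ≤ νΣρ_i`, `SM ≤ νΣM_i`, `SHr ≤ νΣHρ_i`, `SHM ≤ νΣHM_i`,
`SL ≤ νΣL_i`, `SK ≤ νΣK_i`, `0 ≤ SΦ ≤ νΣΦ_i`) and the (B7-CORE) §5 row `G ≤ a₁·AVG + a₂·(Sr + SM) + a₃·(SHr + SHM) + a₄·e²·SΦ + 3·SL + 3·SK`.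
Then `G ≤ A₁·AVG + A₂·C⁺ + (A₃·R⁻² + A₄·e)·N` with the displayed `A`'s. [folklore] -/
theorem summed_budget {ι : Type*} [Fintype ι]
    {N Cplus AVG G Sr SM SHr SHM SL SK SΦ R e ν a₁ a₂ a₃ a₄ : ℝ}
    {cΦ cρCu cρN cKCu cKN cL cMAs cMCu cMR cMe cHCu cHN cHM : ℝ}
    (Ni Cui Asi ρi Φi Ki Li Mi Hρi HMi : ι → ℝ)
    (he0 : 0 ≤ e) (he1 : e ≤ 1) (hν : 0 ≤ ν) (ha₂ : 0 ≤ a₂) (ha₃ : 0 ≤ a₃) (ha₄ : 0 ≤ a₄)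
    (hcΦ : 0 ≤ cΦ) (hcρCu : 0 ≤ cρCu) (hcρN : 0 ≤ cρN) (hcKCu : 0 ≤ cKCu) (hcKN : 0 ≤ cKN) (hcL : 0 ≤ cL)
    (hcMAs : 0 ≤ cMAs) (hcMCu : 0 ≤ cMCu) (hcMR : 0 ≤ cMR) (hcMe : 0 ≤ cMe) (hcHCu : 0 ≤ cHCu) (hcHN : 0 ≤ cHN) (hcHM : 0 ≤ cHM)
    (hΦ : ∀ i, Φi i ≤ cΦ * R ^ 2 * Ni i)
    (hρ : ∀ i, ρi i ≤ cρCu * Cui i + cρN * e * Ni i)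
    (hK : ∀ i, Ki i ≤ cKCu * Cui i + cKN * e * Ni i)
    (hL : ∀ i, Li i ≤ cL * R⁻¹ ^ 2 * Ni i)
    (hM : ∀ i, Mi i ≤ cMAs * Asi i + cMCu * Cui i + (cMR * R⁻¹ ^ 2 + cMe * e) * Ni i)
    (hHρ : ∀ i, Hρi i ≤ cHCu * Cui i + cHN * e * Ni i)
    (hHM : ∀ i, HMi i ≤ cHM * R⁻¹ ^ 2 * Ni i)
    (hsumN : ∑ i, Ni i ≤ ν * N) (hsumCu : ∑ i, Cui i ≤ ν * Cplus) (hsumAs : ∑ i, Asi i ≤ ν * AVG)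
    (hSr : Sr ≤ ν * ∑ i, ρi i) (hSM : SM ≤ ν * ∑ i, Mi i) (hSHr : SHr ≤ ν * ∑ i, Hρi i) (hSHM : SHM ≤ ν * ∑ i, HMi i)
    (hSL : SL ≤ ν * ∑ i, Li i) (hSK : SK ≤ ν * ∑ i, Ki i)
    (hSΦ0 : 0 ≤ SΦ) (hSΦ : SΦ ≤ ν * ∑ i, Φi i)
    (hcore : G ≤ a₁ * AVG + a₂ * (Sr + SM) + a₃ * (SHr + SHM) + a₄ * e ^ 2 * SΦ + 3 * SL + 3 * SK) :
    G ≤ (a₁ + a₂ * ν ^ 2 * cMAs) * AVG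
        + (a₂ * ν ^ 2 * (cρCu + cMCu) + a₃ * ν ^ 2 * cHCu + 3 * ν ^ 2 * cKCu) * Cplus
        + ((a₂ * ν ^ 2 * cMR + a₃ * ν ^ 2 * cHM + 3 * ν ^ 2 * cL) * R⁻¹ ^ 2
            + (a₂ * ν ^ 2 * (cρN + cMe) + a₃ * ν ^ 2 * cHN + a₄ * ν ^ 2 * cΦ * R ^ 2 + 3 * ν ^ 2 * cKN) * e) * N := by
  have he2 : e ^ 2 ≤ e := by rw [pow_two]; exact mul_le_of_le_one_left he0 he1
  -- atoms
  set XA : ℝ := ν * AVG with hXA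
  set XC : ℝ := ν * Cplus with hXC
  set XN : ℝ := ν * N with hXN
  -- the sums of the per-patch bounds
  have sΦ : ∑ i, Φi i ≤ cΦ * R ^ 2 * XN := by
    calc ∑ i, Φi i ≤ ∑ i, cΦ * R ^ 2 * Ni i := Finset.sum_le_sum fun i _ => hΦ i
      _ = cΦ * R ^ 2 * ∑ i, Ni i := by rw [Finset.mul_sum]
      _ ≤ cΦ * R ^ 2 * XN := mul_le_mul_of_nonneg_left hsumN (by positivity)
  have sρ : ∑ i, ρi i ≤ cρCu * XC + cρN * e * XN := by
    calc ∑ i, ρi i ≤ ∑ i, (cρCu * Cui i + cρN * e * Ni i) := Finset.sum_le_sum fun i _ => hρ i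
      _ = cρCu * ∑ i, Cui i + cρN * e * ∑ i, Ni i := by rw [Finset.sum_add_distrib, Finset.mul_sum, Finset.mul_sum]
      _ ≤ _ := add_le_add (mul_le_mul_of_nonneg_left hsumCu hcρCu) (mul_le_mul_of_nonneg_left hsumN (by positivity))
  have sK : ∑ i, Ki i ≤ cKCu * XC + cKN * e * XN := by
    calc ∑ i, Ki i ≤ ∑ i, (cKCu * Cui i + cKN * e * Ni i) := Finset.sum_le_sum fun i _ => hK i
      _ = cKCu * ∑ i, Cui i + cKN * e * ∑ i, Ni i := by rw [Finset.sum_add_distrib, Finset.mul_sum, Finset.mul_sum]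
      _ ≤ _ := add_le_add (mul_le_mul_of_nonneg_left hsumCu hcKCu) (mul_le_mul_of_nonneg_left hsumN (by positivity))
  have sL : ∑ i, Li i ≤ cL * R⁻¹ ^ 2 * XN := by
    calc ∑ i, Li i ≤ ∑ i, cL * R⁻¹ ^ 2 * Ni i := Finset.sum_le_sum fun i _ => hL i
      _ = cL * R⁻¹ ^ 2 * ∑ i, Ni i := by rw [Finset.mul_sum]
      _ ≤ _ := mul_le_mul_of_nonneg_left hsumN (by positivity)
  have sM : ∑ i, Mi i ≤ cMAs * XA + cMCu * XC + (cMR * R⁻¹ ^ 2 + cMe * e) * XN := by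
    calc ∑ i, Mi i ≤ ∑ i, (cMAs * Asi i + cMCu * Cui i + (cMR * R⁻¹ ^ 2 + cMe * e) * Ni i) :=
          Finset.sum_le_sum fun i _ => hM i
      _ = cMAs * ∑ i, Asi i + cMCu * ∑ i, Cui i + (cMR * R⁻¹ ^ 2 + cMe * e) * ∑ i, Ni i := by
          rw [Finset.sum_add_distrib, Finset.sum_add_distrib, Finset.mul_sum, Finset.mul_sum, Finset.mul_sum]
      _ ≤ cMAs * XA + cMCu * XC + (cMR * R⁻¹ ^ 2 + cMe * e) * XN :=
          add_le_add (add_le_add (mul_le_mul_of_nonneg_left hsumAs hcMAs)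
            (mul_le_mul_of_nonneg_left hsumCu hcMCu)) (mul_le_mul_of_nonneg_left hsumN (by positivity))
  have sHρ : ∑ i, Hρi i ≤ cHCu * XC + cHN * e * XN := by
    calc ∑ i, Hρi i ≤ ∑ i, (cHCu * Cui i + cHN * e * Ni i) := Finset.sum_le_sum fun i _ => hHρ i
      _ = cHCu * ∑ i, Cui i + cHN * e * ∑ i, Ni i := by rw [Finset.sum_add_distrib, Finset.mul_sum, Finset.mul_sum]
      _ ≤ _ := add_le_add (mul_le_mul_of_nonneg_left hsumCu hcHCu) (mul_le_mul_of_nonneg_left hsumN (by positivity))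
  have sHM : ∑ i, HMi i ≤ cHM * R⁻¹ ^ 2 * XN := by
    calc ∑ i, HMi i ≤ ∑ i, cHM * R⁻¹ ^ 2 * Ni i := Finset.sum_le_sum fun i _ => hHM i
      _ = cHM * R⁻¹ ^ 2 * ∑ i, Ni i := by rw [Finset.mul_sum]
      _ ≤ _ := mul_le_mul_of_nonneg_left hsumN (by positivity)
  -- the seven global reals
  have gSr : Sr ≤ ν * (cρCu * XC + cρN * e * XN) := hSr.trans (mul_le_mul_of_nonneg_left sρ hν)
  have gSM : SM ≤ ν * (cMAs * XA + cMCu * XC + (cMR * R⁻¹ ^ 2 + cMe * e) * XN) := hSM.trans (mul_le_mul_of_nonneg_left sM hν)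
  have gSHr : SHr ≤ ν * (cHCu * XC + cHN * e * XN) := hSHr.trans (mul_le_mul_of_nonneg_left sHρ hν)
  have gSHM : SHM ≤ ν * (cHM * R⁻¹ ^ 2 * XN) := hSHM.trans (mul_le_mul_of_nonneg_left sHM hν)
  have gSL : SL ≤ ν * (cL * R⁻¹ ^ 2 * XN) := hSL.trans (mul_le_mul_of_nonneg_left sL hν)
  have gSK : SK ≤ ν * (cKCu * XC + cKN * e * XN) := hSK.trans (mul_le_mul_of_nonneg_left sK hν)
  have gSΦ : SΦ ≤ ν * (cΦ * R ^ 2 * XN) := hSΦ.trans (mul_le_mul_of_nonneg_left sΦ hν)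
  have gΦ : a₄ * e ^ 2 * SΦ ≤ a₄ * e * (ν * (cΦ * R ^ 2 * XN)) := by
    calc a₄ * e ^ 2 * SΦ ≤ a₄ * e * SΦ := mul_le_mul_of_nonneg_right (mul_le_mul_of_nonneg_left he2 ha₄) hSΦ0
      _ ≤ a₄ * e * (ν * (cΦ * R ^ 2 * XN)) := mul_le_mul_of_nonneg_left gSΦ (by positivity)
  have gSrM : a₂ * (Sr + SM) ≤ a₂ * (ν * (cρCu * XC + cρN * e * XN)
      + ν * (cMAs * XA + cMCu * XC + (cMR * R⁻¹ ^ 2 + cMe * e) * XN)) :=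
    mul_le_mul_of_nonneg_left (add_le_add gSr gSM) ha₂
  have gSH : a₃ * (SHr + SHM) ≤ a₃ * (ν * (cHCu * XC + cHN * e * XN) + ν * (cHM * R⁻¹ ^ 2 * XN)) :=
    mul_le_mul_of_nonneg_left (add_le_add gSHr gSHM) ha₃
  have step : G ≤ a₁ * AVG + a₂ * (ν * (cρCu * XC + cρN * e * XN)
      + ν * (cMAs * XA + cMCu * XC + (cMR * R⁻¹ ^ 2 + cMe * e) * XN))
      + a₃ * (ν * (cHCu * XC + cHN * e * XN) + ν * (cHM * R⁻¹ ^ 2 * XN))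
      + a₄ * e * (ν * (cΦ * R ^ 2 * XN)) + 3 * (ν * (cL * R⁻¹ ^ 2 * XN)) + 3 * (ν * (cKCu * XC + cKN * e * XN)) := by
    linarith [hcore, gSrM, gSH, gΦ, gSL, gSK]
  have hid : a₁ * AVG + a₂ * (ν * (cρCu * XC + cρN * e * XN)
      + ν * (cMAs * XA + cMCu * XC + (cMR * R⁻¹ ^ 2 + cMe * e) * XN))
      + a₃ * (ν * (cHCu * XC + cHN * e * XN) + ν * (cHM * R⁻¹ ^ 2 * XN))
      + a₄ * e * (ν * (cΦ * R ^ 2 * XN)) + 3 * (ν * (cL * R⁻¹ ^ 2 * XN)) + 3 * (ν * (cKCu * XC + cKN * e * XN))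
      = (a₁ + a₂ * ν ^ 2 * cMAs) * AVG
        + (a₂ * ν ^ 2 * (cρCu + cMCu) + a₃ * ν ^ 2 * cHCu + 3 * ν ^ 2 * cKCu) * Cplus
        + ((a₂ * ν ^ 2 * cMR + a₃ * ν ^ 2 * cHM + 3 * ν ^ 2 * cL) * R⁻¹ ^ 2
            + (a₂ * ν ^ 2 * (cρN + cMe) + a₃ * ν ^ 2 * cHN + a₄ * ν ^ 2 * cΦ * R ^ 2 + 3 * ν ^ 2 * cKN) * e) * N := by
    rw [hXA, hXC, hXN]; ring
  rw [hid] at step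
  exact step

/-! ## §3 Layer A: from the collected row to (REC)'s shape -/

/-- ★★ **(B7-BUDGET) LAYER A — THE (REC) SHAPE FROM THE COLLECTED ROW.**  With `V = ‖D*y‖²`, `P = ‖R D*y‖²` (`V ≤ P + G`, `G = ‖g‖²`), the collected row
`G ≤ A₁·AVG + A₂·C⁺ + (A₃R⁻² + A₄e)·N` at `C⁺ = CURL + 1029e·N` (`CURL ≥ −1029e·N`, ✓`almostPos_DeltaEtaSlot_of_regPr`), and the choice `A₃R⁻² ≤ δ`:
`V ≤ C·(P + AVG + CURL) + ((A₄ + 1029·C)·e + δ)·N`, `C := max 1 (max A₁ A₂)` — the per-member inequality of (REC) VERBATIM up to the names of the reals. [folklore] -/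
theorem rec_shape_of_collected {V P G AVG Cu N e δ R A₁ A₂ A₃ A₄ : ℝ}
    (hP : 0 ≤ P) (hAVG : 0 ≤ AVG) (hN : 0 ≤ N) (he : 0 ≤ e)
    (hCu : -(1029 * e * N) ≤ Cu) (hV : V ≤ P + G)
    (hG : G ≤ A₁ * AVG + A₂ * (Cu + 1029 * e * N) + (A₃ * R⁻¹ ^ 2 + A₄ * e) * N) (hδ : A₃ * R⁻¹ ^ 2 ≤ δ) :
    V ≤ max 1 (max A₁ A₂) * (P + AVG + Cu) + ((A₄ + 1029 * max 1 (max A₁ A₂)) * e + δ) * N := by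
  set C : ℝ := max 1 (max A₁ A₂) with hC
  have hC1 : 1 ≤ C := le_max_left _ _
  have hCA₁ : A₁ ≤ C := (le_max_left _ _).trans (le_max_right _ _)
  have hCA₂ : A₂ ≤ C := (le_max_right _ _).trans (le_max_right _ _)
  have h1 : P ≤ C * P := le_mul_of_one_le_left hP hC1
  have h2 : A₁ * AVG ≤ C * AVG := mul_le_mul_of_nonneg_right hCA₁ hAVG
  have h3 : A₂ * Cu ≤ C * Cu + (C - A₂) * (1029 * e * N) := by
    have : 0 ≤ (C - A₂) * (Cu + 1029 * e * N) := mul_nonneg (by linarith) (by linarith)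
    nlinarith
  have h4 : A₃ * R⁻¹ ^ 2 * N ≤ δ * N := mul_le_mul_of_nonneg_right hδ hN
  have heN : 0 ≤ e * N := mul_nonneg he hN
  have h5 : (A₃ * R⁻¹ ^ 2 + A₄ * e) * N = A₃ * R⁻¹ ^ 2 * N + A₄ * (e * N) := by ring
  rw [h5] at hG
  have h6 : A₂ * (Cu + 1029 * e * N) = A₂ * Cu + A₂ * 1029 * (e * N) := by ring
  rw [h6] at hG
  have hA₂e : A₂ * 1029 * (e * N) ≤ C * 1029 * (e * N) := by
    have := mul_le_mul_of_nonneg_right hCA₂ (show 0 ≤ 1029 * (e * N) by positivity)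
    linarith
  have hfin : max 1 (max A₁ A₂) * (P + AVG + Cu) + ((A₄ + 1029 * max 1 (max A₁ A₂)) * e + δ) * N
      = C * P + C * AVG + C * Cu + A₄ * (e * N) + C * 1029 * (e * N) + δ * N := by rw [← hC]; ring
  rw [hfin]
  have h3' : (C - A₂) * (1029 * e * N) = C * 1029 * (e * N) - A₂ * 1029 * (e * N) := by ring
  rw [h3'] at h3
  linarith

end Summit.QuantumFields.YangMills.Theorems.Prop7DivRecoveryAssemblyBudget

end
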